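import Mathlib.Data.Rat.Floor
import Mathlib.Tactic.FinCases
import Mathlib.Algebra.Order.BigOperators.Group.Finset
import Mathlib.Tactic.Linarith
import Mathlib.Tactic.Ring
import Literature.MathematicalPhysics.QuantumFieldTheory.Volkov2020.DenominatorSectorExponent
import HarnessLib

/-!
# Volkov 2020 (NPB 961, 115232) §3.3 «making the degrees positive» — the proof of Theorem 3.1: from (3.12)–(3.13), Lemma 3.7's weights r_i ∈ {0,1} and the standing hypothesis «ω(s) < 0 except ∅, E(G)», half-unit modified weights r′_i ≥ 0 whose exponents are ≥ max(⌈−ω(IClos(s^{[l]}))⌉ − ½, ½) at every level l ≥ 2 — PROVED (the printed case analysis, verbatim)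

independent recomputation; certified where stated, statistical where stated; no new-physics claim.

CITATION HEADER (venture `QEDPrecision`, cell `pub-qed`, track TROPICAL seat V3b = `pub-qed-trop-v3-lit-2` gen 8; VALUE-FREE: exponent bookkeeping
only — no integrand, nothing per word). Companion of `Volkov2020.HeppSectorTreeBounds` (Lemmas 3.1–3.3), `Volkov2020.DenominatorSectorExponent`
(eq. (3.4); its `iClos`, `capturedPh`, `suffix` are reused here), `Volkov2020.CapturedPhotonBound` (Lemmas 3.6–3.7), `Volkov2020.UVDegreeHandshake` (ω)
and `Volkov2020.SpeerFormHalf` (Theorem 3.1 ⇒ eq. (1.9), which consumes «all exponents ≥ ½»). Serves `tropical/view/V3-VOLKOV-DEGREES.md` §B B.29.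

Source. [Volkov2020] S. Volkov, "Infrared and ultraviolet power counting on the mass shell in quantum electrodynamics", Nucl. Phys. B 961
(2020) 115232 = arXiv:1912.04885v4 (e-print tex `iclos_arxiv.tex` held by the cell; journal pages from the cell's SCOAP3 page files), VERBATIM:
* §2.1 (journal p.7; tex l.162): "We suppose that G does not have lepton cycles, and ω(s) < 0 for all s ⊆ E(G) except the empty set and E(G)."
  (ω(s) = 2·Loop(s) − |s| + ½|Lept(s)|; "IClos(s) = s ∪ {i ∈ Ph(E(G)) : LPath(i) ⊆ s}", tex l.171–173.)
* §3.1 (journal p.10; tex l.290–303): "P[s] = {a ∈ P : a ⊆ s}", "s^{[l]} = {j_l, j_{l+1}, …, j_L}", "t_1, …, t_L ≤ 1".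
* §3.2 (journal p.13; tex l.394–405): "If r_i ≥ 0, i ∈ Ph(E(G)) are some real numbers, M = Σ_i r_i, then we have |W(z)|^M ≥ C·∏_i((z′_i)²/max(z′_i,z_i))^{r_i}
  = C·∏_l t_l^{a_l} (3.4)"; Lemma 3.5 (journal p.13; tex l.406–420): "|K(z)/W(z)^M| ≤ C ∏_{l=1}^{L} t_l^{⌈−ω(IClos(s^{[l]}))⌉+A_l+B_l}/(z_1…z_L), (3.5) where
  A_l = ⌊|Lept(s^{[l]})|/2⌋ − |P(s^{[l]})| − Σ_{i∈Ph(IClos(s^{[l]}))} r_i, (3.6)  B_l = Σ_{i∈IClos(s^{[l]})∖s^{[l]}} (1 − r_i), (3.7)".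
* Lemma 3.7 (journal p.14; tex l.460–465): "There exist numbers r_i ∈ {0,1} for i ∈ Ph(E(G)) such that Σ_i r_i = L + u[P] and for any l = 1, …, L we
  have Σ_{i∈Ph(IClos(s^{[l]}))} r_i ≤ ⌊Lept(s^{[l]})/2⌋ − |P[s^{[l]}]|. (3.8)", "L + u[P] = |Ph(E(G))| − |P|", "(because |P| ≤ |Ph(E(G))|)".
* journal p.15 (tex l.485–488): "Lemmas 3.5 and 3.7 lead to … |K(z)/W(z)^{L+u[P]}| ≤ C ∏_{l=1}^{L} t_l^{⌈−ω(IClos(s^{[l]}))⌉}/(z_1…z_L). However, this is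
  insufficient for proving the convergence of the integral, because the powers must be positive for all l ≥ 2, but IClos(s) = E(G) for some
  s ≠ E(G) and ω(E(G)) = 0. Thus, a more meticulous treatment is required to make the powers positive."
* §3.3, after Lemma 3.9 (journal p.17; tex l.560–571): "Let us denote by i₀ the value of i on which the maximum (3.11) is reached. As a consequence of
  Lemma 3.9, we have the following inequality in terms of Lemma 3.5: |K(z)Σ_{j:P_j=P}[𝒜Π_j]Y_j(z)/W(z)^M| ≤ C·∏_{l=1}^{L}
  t_l^{⌈−ω(IClos(s^{[l]}))⌉+A_l+B_l+C_l}/(z_1…z_L), (3.12) where C_l = 1, if |P| = 0 and i₀ ∈ IClos(s^{[l]})∖s^{[l]}, 0 in the other cases. (3.13)"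
* **Theorem 3.1** (journal p.17; tex l.574–579): "For the Feynman parametric integrand I′(z_1, …, z_L) we have |I′(z_1,…,z_L)| ≤ C·∏_{l=2}^{L}
  t_l^{max(⌈−ω(IClos(s^{[l]}))⌉ − ½, ½)}/(z_1…z_L), where C is some constant depending only on the structure of the graph. Let us remark that we
  ignore the multiplier containing t_1 (because we use the Feynman parameters, 1/L ≤ t_1 ≤ 1)."
* **its proof** (journal p.17; tex l.580–602): "Let us fix P, i₀ (for |P| = 0) and define r_i for i ∈ Ph(E(G)) using Lemma 3.7. We will use (3.12),
  but with A′_l, B′_l, C′_l instead of A_l, B_l, C_l, where A′_l, B′_l, C′_l are defined by the rules (3.6), (3.7), (3.13), but with r′_i instead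
  of r_i. … Let us choose j₀ ∈ Ph(E(G)) such that j₀ ∉ s^{[l]} for all l satisfying l ≥ 2, Lept(E(G)) ⊆ s^{[l]} (it is sufficient to examine
  the minimal l satisfying this). To prove the theorem it is enough to obtain real numbers r′_i ≥ 0 for i ∈ Ph(E(G)) such that Σ_i r′_i =
  |Ph(E(G))| − |P| and A′_l + B′_l + C′_l ≥ 1/2 for all l satisfying Lept(E(G)) ⊆ s^{[l]}, A′_l + B′_l + C′_l ≥ −1/2 for the other l (l ≥ 2).
  There are two cases: 1. |P| ≥ 1. … • r_{j₀} = 0; in this case, we put r′_i = r_i for all i and we have A′_l ≥ 0, C′_l ≥ 0; B′_l ≥ 1 for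
  Lept(E(G)) ⊆ s^{[l]}, B′_l ≥ 0 for the other cases; • r_{j₀} = 1; let us take j such that r_j = 0 (we always can do this, because Σ_i(1 − r_i)
  = |P| > 0); put r′_{j₀} = 1/2, r′_j = 1/2, r′_i = r_i for the other i; we have A′_l = 0, B′_l ≥ 1/2, C′_l ≥ 0 for Lept(E(G)) ⊆ s^{[l]}, A′_l ≥
  A_l − 1/2 ≥ −1/2, B′_l ≥ 0, C′_l ≥ 0 for the other cases. 2. |P| = 0. … • i₀ = j₀; in this case, we put r′_i = r_i for all i and we have
  A′_l ≥ 0, B′_l ≥ 0; C_l = 1 for Lept(E(G)) ⊆ s^{[l]}, C_l ≥ 0 for the other cases; • i₀ ≠ j₀, r_{j₀} = 0; put r′_i = r_i for all i and we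
  have A′_l ≥ 0, C′_l ≥ 0; B′_l ≥ 1 for Lept(E(G)) ⊆ s^{[l]}, B′_l ≥ 0 for the other cases; • i₀ ≠ j₀, r_{j₀} = 1; put r′_{j₀} = 1/2, r′_{i₀}
  = r_{i₀} + 1/2, r′_i = r_i for the other i; we have A′_l = 0, B′_l + C′_l ≥ 1/2 for Lept(E(G)) ⊆ s^{[l]} (if i₀ ∈ IClos(s^{[l]})∖s^{[l]},
  then C′_l = 1 will compensate r′_{i₀} > 1 if occur), A′_l ≥ A_l − 1/2 ≥ −1/2, B′_l + C′_l ≥ 0 for the other cases (analogously). The theorem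
  is proved."

READING (V3 §B.28, `DenominatorSectorExponent`, `CapturedPhotonBound`): «Ph(IClos(s))» in (3.6)/(3.8) is the set of photons CAPTURED by s,
`capturedPh Ph lpath s = {i ∈ Ph : LPath(i) ⊆ s}`; the literal Ph(s) ∪ {captured} makes Lemma 3.7 false. IClos(s)∖s (in B_l, C_l) is unambiguous.

WHAT THE KERNEL CERTIFIES. (1) `PositiveDegrees.exists_halfUnit_weights` — the printed case analysis as ONE abstract statement: photons `ph`, |P| =
`pcard`, weights r ∈ {0,1} with Σ_{ph} r = |ph| − |P| (so |P| ≤ |ph|), any family of levels with «captured» sets `cap l` (= ph at the full levels), «outside»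
sets `out l`, integers a_l with Σ_{cap l} r ≤ a_l ((3.8), i.e. A_l ≥ 0), i₀ ∈ ph when |P| = 0, and a photon j₀ lying in `out l` at every full level
⇒ weights r′ ≥ 0, Σ_{ph} r′ = |ph| − |P|, with A′_l + B′_l + C′_l ≥ ½ at full levels and ≥ −½ elsewhere — r′ is LITERALLY the printed one in each of
the five sub-cases (r, or r with r′_{j₀} = ½ and r′_j = ½, or r with r′_{j₀} = ½ and r′_{i₀} = r_{i₀} + ½). Only the printed lower bounds are used
(the printed «A′_l = 0» at full levels is not needed: A′_l = A_l ≥ 0 there because `cap l = ph` and Σ_{ph} r′ = Σ_{ph} r). (2) `PositiveDegrees.le_of_full`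
/ `le_of_neg`: ⌈−0⌉ + e ≥ max(−½, ½) for e ≥ ½, and ω < 0 ⇒ ⌈−ω⌉ ≥ 1 ⇒ ⌈−ω⌉ + e ≥ max(⌈−ω⌉ − ½, ½) for e ≥ −½ — no half-integrality of ω needed.
(3) **`thm31_exponents`** — in the sector language of `DenominatorSectorExponent` (lines = positions `Fin L` in the order z_{j₁} ≥ ⋯ ≥ z_{j_L},
s^{[l]} = `suffix L (l−1)`, photons `Ph`, lepton paths `lpath i` disjoint from `Ph`): under «ω(E(G)) = 0 and ω(s) < 0 for every s ≠ ∅, E(G)»,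
for Lemma 3.7's r and ANY integers a with (3.8), there are r′ ≥ 0 with Σ_{Ph} r′ = |Ph| − |P| such that for every level 2 ≤ l ≤ L
  ⌈−ω(IClos(s^{[l]}))⌉ + A′_l + B′_l + C′_l ≥ max(⌈−ω(IClos(s^{[l]}))⌉ − ½, ½),
with A′, B′, C′ the rules (3.6), (3.7), (3.13) evaluated at r′; j₀ is taken to be the largest line j₁ itself (it lies outside every s^{[l]}, l ≥ 2,
and is a photon as soon as some such level contains all lepton lines — the printed «it is sufficient to examine the minimal l»); «full level» ⟺
IClos(s^{[l]}) = E(G) (`iClos_eq_univ_of_full`, `full_of_iClos_eq_univ`). With (3.12) for the real weights r′ ((3.4) holds for real r_i ≥ 0) and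
t_l ≤ 1 this is Theorem 3.1's display; `SpeerFormHalf` takes it from there to (1.9).
NOT claimed: (3.12) itself — i.e. Lemma 3.3's numerator bound for K(z), Lemma 3.4, Lemmas 3.8–3.9 (Dirac algebra, the projector 𝒜) — nor the
Feynman-parametric construction of §2.2; the weights' relation Σ r = L + u[P] is taken in the printed form |Ph(E(G))| − |P|.
-/

namespace Literature.MathematicalPhysics.QuantumFieldTheory.Volkov2020

open Finset

namespace PositiveDegrees

variable {ι : Type*}

/-- **A_l of (3.6) for real weights w**: A_l(w) = a_l − Σ_{i ∈ Ph(IClos(s^{[l]}))} w_i with a_l = ⌊|Lept(s^{[l]})|/2⌋ − |P[s^{[l]}]| ∈ ℤ and the photon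
set `cap` = the photons captured by s^{[l]}. [cite: Volkov2020, Lemma 3.5 eq. (3.6) (journal p.13; tex l.412–414)] -/
def aTerm (a : ℤ) (cap : Finset ι) (w : ι → ℚ) : ℚ := (a : ℚ) - ∑ i ∈ cap, w i

/-- **B_l of (3.7)**: B_l(w) = Σ_{i ∈ IClos(s^{[l]})∖s^{[l]}} (1 − w_i), `out` = IClos(s^{[l]})∖s^{[l]}.
[cite: Volkov2020, Lemma 3.5 eq. (3.7) (journal p.13; tex l.415–417)] -/
def bTerm (out : Finset ι) (w : ι → ℚ) : ℚ := ∑ i ∈ out, (1 - w i)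

/-- **C_l of (3.13)**: 1 if |P| = 0 and i₀ ∈ IClos(s^{[l]})∖s^{[l]}, 0 in the other cases.
[cite: Volkov2020, §3.3 eq. (3.13) (journal p.17; tex l.565–571)] -/
def cTerm [DecidableEq ι] (pcard : ℕ) (i0 : ι) (out : Finset ι) : ℚ := if pcard = 0 ∧ i0 ∈ out then 1 else 0

/-- The half-unit modification at one photon: `bump j c i = c` if i = j, else 0 («put r′_{j₀} = 1/2, r′_j = 1/2»).
[cite: Volkov2020, proof of Theorem 3.1 (journal p.17; tex l.591, l.598)] -/
def bump [DecidableEq ι] (j : ι) (c : ℚ) (i : ι) : ℚ := if i = j then c else 0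

/-- Summing a one-point bump over a set. [folklore] -/
private theorem sum_bump [DecidableEq ι] (s : Finset ι) (j : ι) (c : ℚ) :
    ∑ i ∈ s, bump j c i = if j ∈ s then c else 0 := by
  simp only [bump]
  exact Finset.sum_ite_eq' s j fun _ => c

/-- A_l is affine in the weights. [folklore] -/
private theorem aTerm_add (a : ℤ) (cap : Finset ι) (f g : ι → ℚ) :
    aTerm a cap (fun i => f i + g i) = aTerm a cap f - ∑ i ∈ cap, g i := by
  unfold aTerm
  rw [Finset.sum_add_distrib]
  ring

/-- B_l is affine in the weights. [folklore] -/
private theorem bTerm_add (out : Finset ι) (f g : ι → ℚ) :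
    bTerm out (fun i => f i + g i) = bTerm out f - ∑ i ∈ out, g i := by
  unfold bTerm
  rw [← Finset.sum_sub_distrib]
  exact Finset.sum_congr rfl fun i _ => by ring

/-- B_l ≥ 0 for weights ≤ 1 («B′_l ≥ 0»). [cite: Volkov2020, proof of Theorem 3.1 (journal p.17; tex l.590–592)] -/
theorem bTerm_nonneg (out : Finset ι) {f : ι → ℚ} (hf : ∀ i, f i ≤ 1) : 0 ≤ bTerm out f :=
  Finset.sum_nonneg fun i _ => sub_nonneg.2 (hf i)

/-- B_l ≥ 1 − r_j for any j ∈ IClos(s^{[l]})∖s^{[l]} («B′_l ≥ 1 for Lept(E(G)) ⊆ s^{[l]}» when r_{j₀} = 0).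
[cite: Volkov2020, proof of Theorem 3.1 (journal p.17; tex l.590)] -/
theorem sub_le_bTerm (out : Finset ι) {f : ι → ℚ} (hf : ∀ i, f i ≤ 1) {j : ι} (hj : j ∈ out) :
    1 - f j ≤ bTerm out f :=
  Finset.single_le_sum (f := fun i => 1 - f i) (fun i _ => sub_nonneg.2 (hf i)) hj

/-- C_l ≥ 0. [cite: Volkov2020, §3.3 eq. (3.13) (journal p.17; tex l.565–571)] -/
theorem cTerm_nonneg [DecidableEq ι] (pcard : ℕ) (i0 : ι) (out : Finset ι) : 0 ≤ cTerm pcard i0 out := by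
  unfold cTerm
  by_cases h : pcard = 0 ∧ i0 ∈ out
  · rw [if_pos h]; norm_num
  · rw [if_neg h]

/-- C_l = 1 when |P| = 0 and i₀ ∈ IClos(s^{[l]})∖s^{[l]}. [cite: Volkov2020, §3.3 eq. (3.13) (journal p.17; tex l.565–571)] -/
theorem cTerm_eq_one [DecidableEq ι] {pcard : ℕ} {i0 : ι} {out : Finset ι} (h : pcard = 0 ∧ i0 ∈ out) : cTerm pcard i0 out = 1 :=
  if_pos h

/-- An indicator times −½ lies in [−½, 0]. [folklore] -/
private theorem ite_neg_half_bounds (p : Prop) [Decidable p] :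
    -1 / 2 ≤ (if p then (-1 / 2 : ℚ) else 0) ∧ (if p then (-1 / 2 : ℚ) else 0) ≤ 0 := by
  by_cases h : p
  · rw [if_pos h]; norm_num
  · rw [if_neg h]; norm_num

/-- An indicator times ½ lies in [0, ½]. [folklore] -/
private theorem ite_half_bounds (p : Prop) [Decidable p] :
    0 ≤ (if p then (1 / 2 : ℚ) else 0) ∧ (if p then (1 / 2 : ℚ) else 0) ≤ 1 / 2 := by
  by_cases h : p
  · rw [if_pos h]; norm_num
  · rw [if_neg h]; norm_num

/-- The modified weights r′ = r − ½·𝟙_{j₀} + ½·𝟙_x stay ≥ 0 when r_{j₀} = 1 and x ≠ j₀. [folklore] -/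
private theorem bump_nonneg [DecidableEq ι] {R : ι → ℚ} (hRnn : ∀ i, 0 ≤ R i) {j0 x : ι} (hRj0 : R j0 = 1) (hx : x ≠ j0) (i : ι) :
    0 ≤ R i + (bump j0 (-1 / 2) i + bump x (1 / 2) i) := by
  unfold bump
  by_cases h1 : i = j0
  · subst h1
    rw [if_pos rfl, if_neg (fun h => hx h.symm), hRj0]
    norm_num
  · rw [if_neg h1]
    by_cases h2 : i = x
    · rw [if_pos h2]; linarith [hRnn i]
    · rw [if_neg h2]; linarith [hRnn i]

/-- **The two half-unit sub-cases of the proof of Theorem 3.1 in one statement**: with r_{j₀} = 1 and a photon x ≠ j₀ (x = j with r_j = 0 when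
|P| ≥ 1; x = i₀ when |P| = 0) such that B_l + C_l ≥ ½ at every level whose IClos(s^{[l]})∖s^{[l]} contains x, the weights r′ = r except
r′_{j₀} = ½, r′_x = r_x + ½ are ≥ 0, keep Σ_{Ph} r′ = |Ph(E(G))| − |P|, and give A′_l + B′_l + C′_l ≥ ½ at the full levels (those with
Lept(E(G)) ⊆ s^{[l]}, where every photon is captured and j₀ ∈ IClos(s^{[l]})∖s^{[l]}) and ≥ −½ at the other levels.
[cite: Volkov2020, proof of Theorem 3.1, sub-cases «r_{j₀} = 1» (journal p.17; tex l.591–592, l.598–599)] -/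
theorem exists_weights_of_bump [DecidableEq ι] {Λ : Type*} (ph : Finset ι) (pcard : ℕ) (R : ι → ℚ) (hRnn : ∀ i, 0 ≤ R i) (hRle : ∀ i, R i ≤ 1)
    (hRsum : ∑ i ∈ ph, R i = (ph.card : ℚ) - pcard)
    (cap out : Λ → Finset ι) (full : Λ → Prop) (hcap : ∀ l, full l → cap l = ph)
    (a : Λ → ℤ) (hA : ∀ l, ∑ i ∈ cap l, R i ≤ a l) (i0 j0 x : ι)
    (hj0ph : j0 ∈ ph) (hxph : x ∈ ph) (hRj0 : R j0 = 1) (hx : x ≠ j0)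
    (hj0out : ∀ l, full l → j0 ∈ out l)
    (hxout : ∀ l, x ∈ out l → 1 / 2 ≤ bTerm (out l) R + cTerm pcard i0 (out l)) :
    ∃ w : ι → ℚ, (∀ i, 0 ≤ w i) ∧ ∑ i ∈ ph, w i = (ph.card : ℚ) - pcard ∧
      ∀ l, (full l → 1 / 2 ≤ aTerm (a l) (cap l) w + bTerm (out l) w + cTerm pcard i0 (out l)) ∧
        (¬full l → -1 / 2 ≤ aTerm (a l) (cap l) w + bTerm (out l) w + cTerm pcard i0 (out l)) := by
  set g : ι → ℚ := fun i => bump j0 (-1 / 2) i + bump x (1 / 2) i with hgdef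
  have hg : ∀ s : Finset ι,
      ∑ i ∈ s, g i = (if j0 ∈ s then (-1 / 2 : ℚ) else 0) + (if x ∈ s then (1 / 2 : ℚ) else 0) := fun s => by
    simp only [hgdef]
    rw [Finset.sum_add_distrib, sum_bump, sum_bump]
  have hAnn : ∀ l, 0 ≤ aTerm (a l) (cap l) R := fun l => by unfold aTerm; linarith [hA l]
  have hBnn : ∀ l, 0 ≤ bTerm (out l) R := fun l => bTerm_nonneg _ hRle
  have hCnn : ∀ l, 0 ≤ cTerm pcard i0 (out l) := fun l => cTerm_nonneg _ _ _
  -- B_l + C_l ≥ [x ∈ out]/2: the printed «B′_l ≥ 1/2» resp. «C′_l = 1 will compensate»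
  have hxo : ∀ l, (if x ∈ out l then (1 / 2 : ℚ) else 0) ≤ bTerm (out l) R + cTerm pcard i0 (out l) := fun l => by
    by_cases h : x ∈ out l
    · rw [if_pos h]; linarith [hxout l h]
    · rw [if_neg h]; linarith [hBnn l, hCnn l]
  refine ⟨fun i => R i + g i, fun i => bump_nonneg hRnn hRj0 hx i, ?_, fun l => ⟨fun hl => ?_, fun _ => ?_⟩⟩
  · rw [Finset.sum_add_distrib, hg, hRsum, if_pos hj0ph, if_pos hxph]; ring
  · -- full level: A′_l = A_l ≥ 0, B′_l + C′_l ≥ 1/2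
    have hA' : 0 ≤ aTerm (a l) ph R := hcap l hl ▸ hAnn l
    rw [aTerm_add, bTerm_add, hg, hg, hcap l hl, if_pos hj0ph, if_pos hxph, if_pos (hj0out l hl)]
    linarith [hxo l, hA']
  · -- other level: A′_l ≥ A_l − 1/2 ≥ −1/2, B′_l + C′_l ≥ 0
    rw [aTerm_add, bTerm_add, hg, hg]
    have h1 := ite_neg_half_bounds (j0 ∈ cap l)
    have h2 := ite_half_bounds (x ∈ cap l)
    have h3 := ite_neg_half_bounds (j0 ∈ out l)
    linarith [hAnn l, hxo l, h1.1, h1.2, h2.1, h2.2, h3.1, h3.2]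

/-- **Proof of Theorem 3.1, the weights r′ (all five sub-cases)**: photons `ph`, |P| = `pcard`, Lemma 3.7's r ∈ {0,1} with Σ_{ph} r =
|Ph(E(G))| − |P| (whence |P| ≤ |ph|); levels with captured-photon sets `cap l` (equal to `ph` at the full levels Lept(E(G)) ⊆ s^{[l]}), sets `out l` =
IClos(s^{[l]})∖s^{[l]}, integers a_l = ⌊|Lept(s^{[l]})|/2⌋ − |P[s^{[l]}]| with (3.8) Σ_{cap l} r ≤ a_l; i₀ ∈ ph (when |P| = 0); and, if some
level is full, a photon j₀ with j₀ ∈ IClos(s^{[l]})∖s^{[l]} at every full level. THEN there are real r′_i ≥ 0 with Σ_{ph} r′ = |ph| − |P| and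
A′_l + B′_l + C′_l ≥ ½ at the full levels, ≥ −½ at the others — «To prove the theorem it is enough to obtain real numbers r′_i ≥ 0 … such
that …». [cite: Volkov2020, proof of Theorem 3.1 (journal p.17; tex l.580–602)] -/
theorem exists_halfUnit_weights [DecidableEq ι] {Λ : Type*} (ph : Finset ι) (pcard : ℕ)
    (r : ι → ℚ) (hr01 : ∀ i, r i = 0 ∨ r i = 1) (hrsum : ∑ i ∈ ph, r i = (ph.card : ℚ) - pcard)
    (cap out : Λ → Finset ι) (full : Λ → Prop) (hcap : ∀ l, full l → cap l = ph)
    (a : Λ → ℤ) (hA : ∀ l, ∑ i ∈ cap l, r i ≤ a l)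
    (i0 : ι) (hi0 : pcard = 0 → i0 ∈ ph)
    (hj0 : (∃ l, full l) → ∃ j0 ∈ ph, ∀ l, full l → j0 ∈ out l) :
    ∃ w : ι → ℚ, (∀ i, 0 ≤ w i) ∧ ∑ i ∈ ph, w i = (ph.card : ℚ) - pcard ∧
      ∀ l, (full l → 1 / 2 ≤ aTerm (a l) (cap l) w + bTerm (out l) w + cTerm pcard i0 (out l)) ∧
        (¬full l → -1 / 2 ≤ aTerm (a l) (cap l) w + bTerm (out l) w + cTerm pcard i0 (out l)) := by
  have hRnn : ∀ i, 0 ≤ r i := fun i => by rcases hr01 i with h | h <;> simp [h]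
  have hRle : ∀ i, r i ≤ 1 := fun i => by rcases hr01 i with h | h <;> simp [h]
  have hAnn : ∀ l, 0 ≤ aTerm (a l) (cap l) r := fun l => by unfold aTerm; linarith [hA l]
  have hBnn : ∀ l, 0 ≤ bTerm (out l) r := fun l => bTerm_nonneg _ hRle
  have hCnn : ∀ l, 0 ≤ cTerm pcard i0 (out l) := fun l => cTerm_nonneg _ _ _
  -- r′ = r is fine at every level that is not full
  have hbase : ∀ l, -1 / 2 ≤ aTerm (a l) (cap l) r + bTerm (out l) r + cTerm pcard i0 (out l) := fun l => by
    linarith [hAnn l, hBnn l, hCnn l]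
  by_cases hfull : ∃ l, full l
  swap
  · exact ⟨r, hRnn, hrsum, fun l => ⟨fun hl => absurd ⟨l, hl⟩ hfull, fun _ => hbase l⟩⟩
  obtain ⟨j0, hj0ph, hj0out⟩ := hj0 hfull
  rcases hr01 j0 with h0 | h1
  · -- r_{j₀} = 0 (either |P|): r′ = r; at a full level B′_l ≥ 1 − r_{j₀} = 1
    refine ⟨r, hRnn, hrsum, fun l => ⟨fun hl => ?_, fun _ => hbase l⟩⟩
    have hB1 : 1 - r j0 ≤ bTerm (out l) r := sub_le_bTerm _ hRle (hj0out l hl)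
    rw [h0] at hB1
    linarith [hAnn l, hCnn l]
  · by_cases hp : pcard = 0
    · by_cases hij : i0 = j0
      · -- |P| = 0, i₀ = j₀: r′ = r; at a full level C_l = 1
        refine ⟨r, hRnn, hrsum, fun l => ⟨fun hl => ?_, fun _ => hbase l⟩⟩
        have hC1 : cTerm pcard i0 (out l) = 1 := cTerm_eq_one ⟨hp, hij ▸ hj0out l hl⟩
        linarith [hAnn l, hBnn l]
      · -- |P| = 0, i₀ ≠ j₀, r_{j₀} = 1: r′_{j₀} = 1/2, r′_{i₀} = r_{i₀} + 1/2 («C′_l = 1 will compensate r′_{i₀} > 1 if occur»)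
        exact exists_weights_of_bump ph pcard r hRnn hRle hrsum cap out full hcap a hA i0 j0 i0 hj0ph (hi0 hp) h1 hij
          hj0out fun l hl => by
            have := cTerm_eq_one ⟨hp, hl⟩
            linarith [hBnn l]
    · -- |P| ≥ 1, r_{j₀} = 1: «take j such that r_j = 0 (we always can do this, because Σ_i (1 − r_i) = |P| > 0)»
      have hj : ∃ j ∈ ph, r j = 0 := by
        by_contra hne
        have hall : ∀ j ∈ ph, r j = 1 := fun j hj =>
          (hr01 j).resolve_left fun h => hne ⟨j, hj, h⟩
        have hsum1 : ∑ i ∈ ph, r i = (ph.card : ℚ) := by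
          rw [Finset.sum_congr rfl hall, Finset.sum_const, nsmul_eq_mul, mul_one]
        have hp1 : (1 : ℚ) ≤ pcard := by exact_mod_cast Nat.one_le_iff_ne_zero.mpr hp
        linarith [hrsum, hsum1]
      obtain ⟨j, hjph, hj0'⟩ := hj
      have hjne : j ≠ j0 := fun h => by rw [h, h1] at hj0'; norm_num at hj0'
      exact exists_weights_of_bump ph pcard r hRnn hRle hrsum cap out full hcap a hA i0 j0 j hj0ph hjph h1 hjne
        hj0out fun l hl => by
          have hB1 : 1 - r j ≤ bTerm (out l) r := sub_le_bTerm _ hRle hl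
          rw [hj0'] at hB1
          linarith [hCnn l]

/-- At a full level (IClos(s^{[l]}) = E(G), ω(E(G)) = 0): ⌈−ω⌉ + (A′_l + B′_l + C′_l) ≥ 0 + ½ = max(⌈−0⌉ − ½, ½).
[cite: Volkov2020, Theorem 3.1 and journal p.15 «ω(E(G)) = 0» (journal p.15, p.17; tex l.487–488, l.574–579)] -/
theorem le_of_full {ω e : ℚ} (hω : ω = 0) (he : 1 / 2 ≤ e) :
    max ((⌈-ω⌉ : ℚ) - 1 / 2) (1 / 2) ≤ (⌈-ω⌉ : ℚ) + e := by
  subst hω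
  rw [neg_zero, Int.ceil_zero, Int.cast_zero, zero_sub, zero_add]
  exact max_le (by linarith) he

/-- At any other level l ≥ 2 (∅ ≠ IClos(s^{[l]}) ≠ E(G), so ω(IClos(s^{[l]})) < 0 by the standing hypothesis): ⌈−ω⌉ ≥ 1, hence
⌈−ω⌉ + (A′_l + B′_l + C′_l) ≥ ⌈−ω⌉ − ½ = max(⌈−ω⌉ − ½, ½). [cite: Volkov2020, §2.1 «ω(s) < 0 for all s ⊆ E(G) except the empty set and E(G)»
and Theorem 3.1 (journal p.7, p.17; tex l.162, l.574–579)] -/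
theorem le_of_neg {ω e : ℚ} (hω : ω < 0) (he : -1 / 2 ≤ e) :
    max ((⌈-ω⌉ : ℚ) - 1 / 2) (1 / 2) ≤ (⌈-ω⌉ : ℚ) + e := by
  have h1 : (1 : ℤ) ≤ ⌈-ω⌉ := by
    have := Int.ceil_pos.mpr (neg_pos.mpr hω)
    omega
  have h1' : (1 : ℚ) ≤ ((⌈-ω⌉ : ℤ) : ℚ) := by exact_mod_cast h1
  exact max_le (by linarith) (by linarith)

end PositiveDegrees

/-! ## In the Hepp sector: levels s^{[l]} = `suffix L (l−1)`, photons `Ph`, lepton paths `lpath`, I-closure `iClos`, captured photons `capturedPh` -/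

section Sector

open PositiveDegrees

variable {L : ℕ}

/-- «Lept(E(G)) ⊆ s^{[l]}»: every lepton line (= every position not in `Ph`) lies in the level set `suffix L k` (k = l − 1).
[cite: Volkov2020, proof of Theorem 3.1 (journal p.17; tex l.584–586)] -/
def FullLevel (Ph : Finset (Fin L)) (k : ℕ) : Prop := ∀ i : Fin L, i ∉ Ph → i ∈ suffix L k

variable {Ph : Finset (Fin L)} {lpath : Fin L → Finset (Fin L)}

/-- At a full level every lepton path lies in the level set (lepton paths consist of lepton lines).
[cite: Volkov2020, §2.1 «LPath(i) … the set of all lines that are on the lepton path» (journal p.7; tex l.166–170)] -/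
theorem lpath_subset_of_full (hpath : ∀ i ∈ Ph, Disjoint (lpath i) Ph) {k : ℕ} (hk : FullLevel Ph k) {i : Fin L}
    (hi : i ∈ Ph) : lpath i ⊆ suffix L k :=
  fun x hx => hk x fun hxP => Finset.disjoint_left.1 (hpath i hi) hx hxP

/-- At a full level every photon is captured: Ph⋆(s^{[l]}) = Ph(E(G)) (so A′_l and A_l have the same photon sum).
[cite: Volkov2020, proof of Theorem 3.1 «A′_l = 0 … for Lept(E(G)) ⊆ s^{[l]}» (journal p.17; tex l.591–592)] -/
theorem capturedPh_eq_of_full (hpath : ∀ i ∈ Ph, Disjoint (lpath i) Ph) {k : ℕ} (hk : FullLevel Ph k) :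
    capturedPh Ph lpath (suffix L k) = Ph := by
  ext i
  simp only [capturedPh, Finset.mem_filter]
  exact ⟨fun h => h.1, fun h => ⟨h, lpath_subset_of_full hpath hk h⟩⟩

/-- At a full level the I-closure is everything: IClos(s^{[l]}) = E(G) («IClos(s) = E(G) for some s ≠ E(G)»).
[cite: Volkov2020, journal p.15 (tex l.487–488)] -/
theorem iClos_eq_univ_of_full (hpath : ∀ i ∈ Ph, Disjoint (lpath i) Ph) {k : ℕ} (hk : FullLevel Ph k) :
    iClos Ph lpath (suffix L k) = univ := by
  ext i
  simp only [iClos, Finset.mem_union, Finset.mem_filter, Finset.mem_univ, iff_true]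
  by_cases hi : i ∈ Ph
  · exact Or.inr ⟨hi, lpath_subset_of_full hpath hk hi⟩
  · exact Or.inl (hk i hi)

/-- Conversely IClos(s) = E(G) forces Lept(E(G)) ⊆ s (the I-closure adds photons only). [cite: Volkov2020, §2.1 (journal p.7; tex l.171–173)] -/
theorem full_of_iClos_eq_univ {s : Finset (Fin L)} (h : iClos Ph lpath s = univ) : ∀ i : Fin L, i ∉ Ph → i ∈ s := by
  intro i hi
  have hmem : i ∈ iClos Ph lpath s := h ▸ Finset.mem_univ i
  simp only [iClos, Finset.mem_union, Finset.mem_filter] at hmem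
  rcases hmem with h' | ⟨hP, _⟩
  · exact h'
  · exact absurd hP hi

/-- For l ≤ L the level set, hence its I-closure, is nonempty. [cite: Volkov2020, §3.1 «s^{[l]} = {j_l, …, j_L}» (journal p.10; tex l.296)] -/
theorem iClos_suffix_nonempty {k : ℕ} (hk : k < L) : (iClos Ph lpath (suffix L k)).Nonempty :=
  ⟨⟨k, hk⟩, by simp [iClos, mem_suffix]⟩

/-- **j₀ := j₁**, the largest line: it is outside s^{[l]} for every l ≥ 2, and at a full level l ≥ 2 it is a photon lying in
IClos(s^{[l]})∖s^{[l]} («choose j₀ ∈ Ph(E(G)) such that j₀ ∉ s^{[l]} for all l satisfying l ≥ 2, Lept(E(G)) ⊆ s^{[l]}»).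
[cite: Volkov2020, proof of Theorem 3.1 (journal p.17; tex l.584–586)] -/
theorem pos_zero_mem_out (hpath : ∀ i ∈ Ph, Disjoint (lpath i) Ph) {k : ℕ} (hk1 : 1 ≤ k) (hL : 0 < L)
    (hk : FullLevel Ph k) :
    (⟨0, hL⟩ : Fin L) ∈ Ph ∧ (⟨0, hL⟩ : Fin L) ∈ iClos Ph lpath (suffix L k) \ suffix L k := by
  have h0 : (⟨0, hL⟩ : Fin L) ∉ suffix L k := by
    rw [mem_suffix]
    simp only [not_le]
    exact hk1
  have hP : (⟨0, hL⟩ : Fin L) ∈ Ph := by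
    by_contra h
    exact h0 (hk _ h)
  refine ⟨hP, Finset.mem_sdiff.2 ⟨?_, h0⟩⟩
  rw [iClos_eq_univ_of_full hpath hk]
  exact Finset.mem_univ _

/-- **Theorem 3.1, the exponent bookkeeping of its proof, in the Hepp sector** (lines = positions `Fin L` in the order z_{j₁} ≥ ⋯ ≥ z_{j_L};
the level l = 1, …, L is the position k = l − 1 and s^{[l]} = `suffix L k`; photons `Ph` with lepton paths `lpath i` made of lepton lines):
assume the standing hypothesis in the form ω(E(G)) = 0 and ω(s) < 0 for all s ≠ ∅, E(G); let r_i ∈ {0,1} be Lemma 3.7's weights (Σ_{Ph} r =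
|Ph(E(G))| − |P| — so |P| ≤ |Ph(E(G))| automatically — and (3.8): Σ_{i ∈ Ph⋆(s^{[l]})} r_i ≤ a_l := ⌊|Lept(s^{[l]})|/2⌋ − |P[s^{[l]}]| for
l = 1, …, L; any integers a_l with (3.8) will do) and i₀ ∈ Ph(E(G)) (for |P| = 0). THEN there are real weights r′_i ≥ 0 with Σ_{Ph} r′ =
|Ph(E(G))| − |P| such that at every level 2 ≤ l ≤ L
  ⌈−ω(IClos(s^{[l]}))⌉ + A′_l + B′_l + C′_l ≥ max(⌈−ω(IClos(s^{[l]}))⌉ − ½, ½),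
A′_l, B′_l, C′_l being (3.6), (3.7), (3.13) at r′ (`aTerm`, `bTerm`, `cTerm`; Ph(IClos(s^{[l]})) read as the captured photons `capturedPh`).
Together with (3.12) for r′ ((3.4) holds for real r_i ≥ 0) and t_l ≤ 1 this is the displayed bound of Theorem 3.1.
[cite: Volkov2020, Theorem 3.1 and its proof (journal p.17; tex l.574–602)] -/
theorem thm31_exponents (Ph : Finset (Fin L)) (lpath : Fin L → Finset (Fin L)) (hpath : ∀ i ∈ Ph, Disjoint (lpath i) Ph)
    (ω : Finset (Fin L) → ℚ) (hωE : ω univ = 0) (hωneg : ∀ s : Finset (Fin L), s.Nonempty → s ≠ univ → ω s < 0)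
    (pcard : ℕ) (r : Fin L → ℚ) (hr01 : ∀ i, r i = 0 ∨ r i = 1)
    (hrsum : ∑ i ∈ Ph, r i = (Ph.card : ℚ) - pcard) (a : Fin L → ℤ)
    (hA : ∀ k : Fin L, ∑ i ∈ capturedPh Ph lpath (suffix L k), r i ≤ a k) (i0 : Fin L) (hi0 : pcard = 0 → i0 ∈ Ph) :
    ∃ w : Fin L → ℚ, (∀ i, 0 ≤ w i) ∧ ∑ i ∈ Ph, w i = (Ph.card : ℚ) - pcard ∧
      ∀ k : Fin L, 1 ≤ (k : ℕ) →
        max ((⌈-ω (iClos Ph lpath (suffix L k))⌉ : ℚ) - 1 / 2) (1 / 2) ≤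
          (⌈-ω (iClos Ph lpath (suffix L k))⌉ : ℚ) +
            (aTerm (a k) (capturedPh Ph lpath (suffix L k)) w + bTerm (iClos Ph lpath (suffix L k) \ suffix L k) w +
              cTerm pcard i0 (iClos Ph lpath (suffix L k) \ suffix L k)) := by
  obtain ⟨w, hw0, hwsum, hlev⟩ :=
    exists_halfUnit_weights (Λ := Fin L) Ph pcard r hr01 hrsum (fun k => capturedPh Ph lpath (suffix L k))
      (fun k => iClos Ph lpath (suffix L k) \ suffix L k) (fun k => 1 ≤ (k : ℕ) ∧ FullLevel Ph k)
      (fun k hk => capturedPh_eq_of_full hpath hk.2) a hA i0 hi0 (by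
        rintro ⟨k, hk1, hk⟩
        have hL : 0 < L := k.pos
        exact ⟨⟨0, hL⟩, (pos_zero_mem_out hpath hk1 hL hk).1, fun k' hk' =>
          (pos_zero_mem_out hpath hk'.1 hL hk'.2).2⟩)
  refine ⟨w, hw0, hwsum, fun k hk1 => ?_⟩
  by_cases hf : FullLevel Ph k
  · have e := (hlev k).1 ⟨hk1, hf⟩
    have hω : ω (iClos Ph lpath (suffix L k)) = 0 := by rw [iClos_eq_univ_of_full hpath hf, hωE]
    exact le_of_full hω e
  · have e := (hlev k).2 fun h => hf h.2
    have hne : iClos Ph lpath (suffix L k) ≠ univ := fun h => hf (full_of_iClos_eq_univ h)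
    exact le_of_neg (hωneg _ (iClos_suffix_nonempty k.isLt) hne) e

/-- In particular every exponent of Theorem 3.1 at the levels 2 ≤ l ≤ L is ≥ ½ > 0 — «the powers must be positive for all l ≥ 2»; this is the
hypothesis `SpeerFormHalf` starts from. [cite: Volkov2020, journal p.15 (tex l.487–488) and Theorem 3.1 (journal p.17)] -/
theorem thm31_exponents_ge_half (Ph : Finset (Fin L)) (lpath : Fin L → Finset (Fin L))
    (hpath : ∀ i ∈ Ph, Disjoint (lpath i) Ph)
    (ω : Finset (Fin L) → ℚ) (hωE : ω univ = 0) (hωneg : ∀ s : Finset (Fin L), s.Nonempty → s ≠ univ → ω s < 0)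
    (pcard : ℕ) (r : Fin L → ℚ) (hr01 : ∀ i, r i = 0 ∨ r i = 1)
    (hrsum : ∑ i ∈ Ph, r i = (Ph.card : ℚ) - pcard) (a : Fin L → ℤ)
    (hA : ∀ k : Fin L, ∑ i ∈ capturedPh Ph lpath (suffix L k), r i ≤ a k) (i0 : Fin L) (hi0 : pcard = 0 → i0 ∈ Ph) :
    ∃ w : Fin L → ℚ, (∀ i, 0 ≤ w i) ∧ ∑ i ∈ Ph, w i = (Ph.card : ℚ) - pcard ∧
      ∀ k : Fin L, 1 ≤ (k : ℕ) →
        (1 / 2 : ℚ) ≤ (⌈-ω (iClos Ph lpath (suffix L k))⌉ : ℚ) +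
            (aTerm (a k) (capturedPh Ph lpath (suffix L k)) w + bTerm (iClos Ph lpath (suffix L k) \ suffix L k) w +
              cTerm pcard i0 (iClos Ph lpath (suffix L k) \ suffix L k)) := by
  obtain ⟨w, hw0, hwsum, h⟩ := thm31_exponents Ph lpath hpath ω hωE hωneg pcard r hr01 hrsum a hA i0 hi0
  exact ⟨w, hw0, hwsum, fun k hk1 => (le_max_right _ _).trans (h k hk1)⟩

end Sector

/-! ## Non-vacuity: the one-loop vertex graph in the sector z_γ ≥ z_a ≥ z_b (a full level l = 2 occurs) -/

section OneLoop

open PositiveDegrees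

/-- The degree function of the ONE-LOOP vertex graph (photon γ at position 0, lepton lines a, b at positions 1, 2): ω(s) = 2·Loop(s) − |s| +
½|Lept(s)| with Loop(s) = 1 iff s = E(G) (the only cycle is the whole graph), Lept(s) = s ∩ {a, b}.
[cite: Volkov2020, §2.1 «ω(s) = 2·Loop(s) − |s| + ½|Lept(s)|» (journal p.7; tex l.157–160)] -/
def oneLoopOmega (s : Finset (Fin 3)) : ℚ :=
  2 * (if s = univ then 1 else 0) - s.card + ((s ∩ {1, 2}).card : ℚ) / 2

/-- The captured photons of the one-loop graph at each level (sector z_γ ≥ z_a ≥ z_b). [folklore] -/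
private theorem oneLoop_captured (k : Fin 3) :
    capturedPh {0} (fun _ => {1, 2}) (suffix 3 k) = if (k : ℕ) ≤ 1 then {0} else ∅ := by
  fin_cases k <;> decide

/-- **Non-vacuity of `thm31_exponents`** on the one-loop vertex graph in the sector z_γ ≥ z_a ≥ z_b (positions 0 = γ, 1 = a, 2 = b; LPath(γ) =
{a, b}; P = ∅; Lemma 3.7's r_γ = 1; a_l = ⌊|Lept(s^{[l]})|/2⌋ = 1, 1, 0; i₀ = γ): ω(E(G)) = 0 and ω(s) < 0 otherwise hold for `oneLoopOmega`,
(3.8) holds, and the level l = 2 (s^{[2]} = {a, b} ⊇ Lept(E(G)), IClos(s^{[2]}) = E(G)) is FULL — the situation «IClos(s) = E(G) for some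
s ≠ E(G)» of journal p.15; the theorem's weights give exponents ≥ ½ at l = 2, 3 (here r′ = r and C₂ = 1: the sub-case i₀ = j₀ = γ).
[cite: Volkov2020, journal p.15 (tex l.487–488) and proof of Theorem 3.1 (journal p.17)] -/
theorem oneLoop_thm31 :
    ∃ w : Fin 3 → ℚ, (∀ i, 0 ≤ w i) ∧ ∑ i ∈ ({0} : Finset (Fin 3)), w i = 1 ∧
      ∀ k : Fin 3, 1 ≤ (k : ℕ) →
        (1 / 2 : ℚ) ≤ (⌈-oneLoopOmega (iClos {0} (fun _ => {1, 2}) (suffix 3 k))⌉ : ℚ) +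
          (aTerm (if (k : ℕ) ≤ 1 then 1 else 0) (capturedPh {0} (fun _ => {1, 2}) (suffix 3 k)) w +
            bTerm (iClos {0} (fun _ => {1, 2}) (suffix 3 k) \ suffix 3 k) w +
            cTerm 0 0 (iClos {0} (fun _ => {1, 2}) (suffix 3 k) \ suffix 3 k)) := by
  have hωE : oneLoopOmega univ = 0 := by
    have h12 : ((univ : Finset (Fin 3)) ∩ {1, 2}).card = 2 := by decide
    simp only [oneLoopOmega, if_true, Finset.card_univ, Fintype.card_fin, h12]
    norm_num
  have hωneg : ∀ s : Finset (Fin 3), s.Nonempty → s ≠ univ → oneLoopOmega s < 0 := by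
    intro s hs hne
    simp only [oneLoopOmega, if_neg hne]
    have h1 : ((s ∩ {1, 2}).card : ℚ) ≤ s.card := by exact_mod_cast Finset.card_le_card Finset.inter_subset_left
    have h2 : (1 : ℚ) ≤ s.card := by exact_mod_cast Finset.card_pos.2 hs
    linarith
  obtain ⟨w, hw0, hwsum, h⟩ :=
    thm31_exponents_ge_half (L := 3) {0} (fun _ => {1, 2}) (by decide) oneLoopOmega hωE hωneg 0
      (fun i => if i = 0 then 1 else 0) (fun i => by by_cases hi : i = 0 <;> simp [hi]) (by simp)
      (fun k => if (k : ℕ) ≤ 1 then 1 else 0)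
      (fun k => by
        rw [oneLoop_captured k]
        by_cases hk : (k : ℕ) ≤ 1
        · rw [if_pos hk, if_pos hk]; simp
        · rw [if_neg hk, if_neg hk]; simp)
      0 (fun _ => by decide)
  exact ⟨w, hw0, by simpa using hwsum, h⟩

end OneLoop

end Literature.MathematicalPhysics.QuantumFieldTheory.Volkov2020
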